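import Mathlib
import HarnessLib
import Literature.MathematicalPhysics.QuantumLattice.FermiRG.BGM2003Main
import Summits.HubbardSuperconductivity.HubbardSuperconductivity.Theorems.KLProgrammeFermiSurfaceBGM2003

/-!
# Route `KLProgramme` (crux K1 `H10TwoPointLimit`, also K3): the Hubbard band belongs to the LATTICE MODEL
# CLASS of Benfatto–Giuliani–Mastropietro 2003 Theorem 1.1, as TYPED in `FermiRG/BGM2003Main.lean`,
# at every shell inside `-4 < μ < 0`

Cell `gate-hubbard-kl`, risk-register item r2 (Fermi-surface hypotheses the typed statements consume).
The typer file `BGM2003Main.lean` (t3) states BGM 2003 Thm 1.1 (2.11), lattice case, as the named fact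
`FermiRG.BGM2003.theorem11_lattice`, quantified over the model class
`FermiRG.BGM2003.LatticeModelHyp ε μ e₀ u v` (§1.2 p.4): a `2πℤ²`-periodic dispersion `ε ≥ 0` vanishing
exactly on `2πℤ²`, the geometric hypotheses (2.8a)–(2.8c) (`DispersionHyp`, instantiated for the Hubbard band in
`KLProgrammeFermiSurfaceBGM2003`), `e₀ < μ`, the shell `{|ε - μ| ≤ e₀}` being exactly the polar annulus
modulo `2πℤ²`, and a pair potential with a summable second moment.

BGM normalise the band to be `≥ 0` with its minimum `0` at `k⃗ = 0`; for the square lattice this is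
`ε_BGM(k) = sqDispersion k + 4 = 4 - 2 cos k₁ - 2 cos k₂` at chemical potential `μ + 4` (no new definition:
the shifted function is written inline). This file proves:

* `klfs_bgm2003_dispersionHyp_add_const` — (2.8a)–(2.8c) are invariant under `(ε, μ) ↦ (ε + c, μ + c)`;
* `klfs_sqDispersion_add_four_nonneg`, `klfs_sqDispersion_add_four_eq_zero_iff`, `klfs_sqDispersion_add_int_mul`
  — positivity, zero set `2πℤ²` and periodicity of `ε_BGM`;
* `klfs_shell_eq_levelPoint` — every `k⃗ ∈ ℝ²` with `|ε(k⃗) - μ| ≤ e₀` (`-4 < μ - e₀`, `μ + e₀ < 0`) is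
  `u(θ, e) e⃗_r(θ) + 2πm⃗` with `|e| ≤ e₀`, `u(θ, e) = bandFermiRadius (μ + e) θ` (reduction to the cell
  `[-π, π)²` by `toIcoMod`, then the tree's `band_eq_of_level`);
* `klfs_bgm2003_latticeModelHyp` — **`LatticeModelHyp (ε + 4) (μ + 4) e₀ u v` for every `0 < e₀`,
  `-4 < μ - e₀`, `μ + e₀ < 0` and every pair potential with summable second moment** (in particular every
  finitely supported one, `klfs_bgm2003_latticeModelHyp_of_finite`, e.g. the on-site Hubbard repulsion);
  window instances `e₀ = 0.08` on `μ ∈ [-0.4267, -0.1798]` and `e₀ = 0.07` on `[-1, -0.15]`;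
* `klfs_bgm2003_theorem11_hubbard` — the CONDITIONAL corollary: the named fact `theorem11_lattice` (unproved
  in the tree) yields its conclusion verbatim for the Hubbard band at every such `μ` (BGM's own printed
  range for the Hubbard example is small filling; the typed class, and hence the typed theorem, covers the
  whole hole-doped band away from `μ = 0, -4`).

No definitions; everything PROVED except what is explicitly taken as the hypothesis `theorem11_lattice`. [folklore]
-/

noncomputable section

open Real Set Filter MeasureTheory
open scoped Topology

-- the tree's namespace `Summit.<Summit>.<Problem>.Theorems` repeats the summit name by design (D-0017)
set_option linter.dupNamespace false

namespace Summit.HubbardSuperconductivity.HubbardSuperconductivity.Theorems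

open Literature.MathematicalPhysics.QuantumLattice
open Literature.Probability.LatticeModels (Site)

/-! ### §1 Shifting the energy origin -/

/-- BGM 2003 §1.2 (2.8a)–(2.8c) only see `ε - μ` and the polar radius `u`: they are invariant under the
simultaneous shift `(ε, μ) ↦ (ε + c, μ + c)`. [folklore] -/
theorem klfs_bgm2003_dispersionHyp_add_const {ε : (Fin 2 → ℝ) → ℝ} {μ e₀ : ℝ} {u : ℝ → ℝ → ℝ} (c : ℝ)
    (h : FermiRG.BGM2003.DispersionHyp ε μ e₀ u) :
    FermiRG.BGM2003.DispersionHyp (fun k => ε k + c) (μ + c) e₀ u where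
  e₀_pos := h.e₀_pos
  smooth_ε := h.smooth_ε.add contDiff_const
  smooth_u := h.smooth_u
  periodic_u := h.periodic_u
  u_pos := h.u_pos
  level θ e he := by rw [h.level θ e he]; ring
  convex := h.convex
  radial := by
    obtain ⟨c₁, c₂, h₁, h₂, h₃⟩ := h.radial
    refine ⟨c₁, c₂, h₁, h₂, fun θ e he => ?_⟩
    rw [fderiv_add_const]
    exact h₃ θ e he
  symm p := by rw [h.symm]
  antipodal := h.antipodal

/-! ### §2 BGM's normalised Hubbard band `ε + 4 = 4 - 2 cos k₁ - 2 cos k₂` -/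

/-- `ε(k⃗) + 4 ≥ 0`. [folklore] -/
theorem klfs_sqDispersion_add_four_nonneg (k : Fin 2 → ℝ) : 0 ≤ sqDispersion k + 4 := by
  unfold sqDispersion
  linarith [Real.cos_le_one (k 0), Real.cos_le_one (k 1)]

/-- `ε(k⃗) + 4 = 0` exactly on the reciprocal lattice `2πℤ²` («strictly positive for `k⃗ ≠ 0` and equal to `0`
for `k⃗ = 0`», on the torus). [folklore] -/
theorem klfs_sqDispersion_add_four_eq_zero_iff (k : Fin 2 → ℝ) :
    sqDispersion k + 4 = 0 ↔ ∃ m : Fin 2 → ℤ, k = fun i => 2 * π * (m i : ℝ) := by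
  constructor
  · intro h
    have h0 : Real.cos (k 0) = 1 := by
      unfold sqDispersion at h
      linarith [Real.cos_le_one (k 0), Real.cos_le_one (k 1)]
    have h1 : Real.cos (k 1) = 1 := by
      unfold sqDispersion at h
      linarith [Real.cos_le_one (k 0), Real.cos_le_one (k 1)]
    obtain ⟨m₀, hm₀⟩ := (Real.cos_eq_one_iff _).1 h0
    obtain ⟨m₁, hm₁⟩ := (Real.cos_eq_one_iff _).1 h1
    refine ⟨![m₀, m₁], funext fun i => ?_⟩
    fin_cases i
    · simp only [Fin.zero_eta, Matrix.cons_val_zero]; rw [← hm₀]; ring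
    · simp only [Fin.mk_one, Matrix.cons_val_one, Matrix.cons_val_zero]; rw [← hm₁]; ring
  · rintro ⟨m, rfl⟩
    have h0 : Real.cos (2 * π * (m 0 : ℝ)) = 1 := by
      rw [show 2 * π * (m 0 : ℝ) = (m 0 : ℝ) * (2 * π) by ring]; exact Real.cos_int_mul_two_pi _
    have h1 : Real.cos (2 * π * (m 1 : ℝ)) = 1 := by
      rw [show 2 * π * (m 1 : ℝ) = (m 1 : ℝ) * (2 * π) by ring]; exact Real.cos_int_mul_two_pi _
    simp only [sqDispersion, h0, h1]; ring

/-- `ε` is `2πℤ²`-periodic. [folklore] -/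
theorem klfs_sqDispersion_add_int_mul (k : Fin 2 → ℝ) (m : Fin 2 → ℤ) :
    sqDispersion (k + fun i => 2 * π * (m i : ℝ)) = sqDispersion k := by
  have h : ∀ i, (k + fun i => 2 * π * (m i : ℝ)) i = k i + (m i : ℝ) * (2 * π) := fun i => by
    simp only [Pi.add_apply]; ring
  simp only [sqDispersion, h, Real.cos_add_int_mul_two_pi]

/-! ### §3 The shell is the polar annulus modulo `2πℤ²` -/

/-- **Every momentum of the shell is a level point** (BGM 2003 §1.2 p.4 L101–113: the level curves `Σ(e)`,
`|e| ≤ e₀`, fill the shell `ℬ`): for `-4 < μ - e₀`, `μ + e₀ < 0` and any `k⃗ ∈ ℝ²` with `|ε(k⃗) - μ| ≤ e₀`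
there are `θ`, `|e| ≤ e₀` and `m⃗ ∈ ℤ²` with `k⃗ = u_{μ+e}(θ) e⃗_r(θ) + 2πm⃗`. Proof: reduce `k⃗` to the cell
`[-π, π)²` coordinatewise (`toIcoMod`), where the tree's `band_eq_of_level` identifies the point with the
polar point of its own level at its own argument. [folklore] -/
theorem klfs_shell_eq_levelPoint {μ e₀ : ℝ} (h₁ : -4 < μ - e₀) (h₂ : μ + e₀ < 0) (k : Fin 2 → ℝ)
    (hk : |sqDispersion k - μ| ≤ e₀) :
    ∃ (θ e : ℝ) (m : Fin 2 → ℤ), |e| ≤ e₀ ∧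
      k = FermiRG.BGM2003.levelPoint (fun ϑ e' => bandFermiRadius (μ + e') ϑ) θ e + fun i => 2 * π * (m i : ℝ) := by
  -- reduction to the cell
  set k' : Fin 2 → ℝ := fun i => toIcoMod Real.two_pi_pos (-π) (k i) with hk'
  set m : Fin 2 → ℤ := fun i => toIcoDiv Real.two_pi_pos (-π) (k i) with hm
  have hdecomp : k = k' + fun i => 2 * π * (m i : ℝ) := by
    funext i
    have h := toIcoMod_add_toIcoDiv_zsmul Real.two_pi_pos (-π) (k i)
    simp only [Pi.add_apply, hk', hm]
    rw [zsmul_eq_mul] at h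
    linarith [h]
  have hk'mem : ∀ i, |k' i| ≤ π := fun i => by
    have h := toIcoMod_mem_Ico Real.two_pi_pos (-π) (k i)
    rw [abs_le]
    exact ⟨h.1, by linarith [h.2]⟩
  have hεk' : sqDispersion k' = sqDispersion k := by
    conv_rhs => rw [hdecomp]
    exact (klfs_sqDispersion_add_int_mul k' m).symm
  -- the level of `k`
  set ν := sqDispersion k with hν
  have hb := abs_le.1 hk
  have hν₁ : -4 < ν := by linarith [hb.1]
  have hν₂ : ν < 0 := by linarith [hb.2]
  have he2 : BandSectorCounting.eps2 (k' 0) (k' 1) = ν := by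
    rw [← hεk']; simp [BandSectorCounting.eps2, sqDispersion]
  obtain ⟨hx, hy⟩ := BandSectorCounting.band_eq_of_level hν₁ hν₂ (hk'mem 0) (hk'mem 1) he2
  set φ := Complex.arg (⟨k' 0, k' 1⟩ : ℂ) with hφ
  refine ⟨φ, ν - μ, m, ?_, ?_⟩
  · rw [abs_le]; exact ⟨by linarith [hb.1], by linarith [hb.2]⟩
  · rw [hdecomp]
    congr 1
    funext i
    have hνe : μ + (ν - μ) = ν := by ring
    fin_cases i
    · simp only [FermiRG.BGM2003.levelPoint, Pi.smul_apply, smul_eq_mul, Fin.zero_eta, dir_zero, hνe]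
      rw [← hx]; rfl
    · simp only [FermiRG.BGM2003.levelPoint, Pi.smul_apply, smul_eq_mul, Fin.mk_one, dir_one, hνe]
      rw [← hy]; rfl

/-! ### §4 The lattice model class -/

/-- **The Hubbard band is in BGM 2003's lattice model class** (§1.2 p.4, as typed by
`FermiRG.BGM2003.LatticeModelHyp`): for `0 < e₀`, `-4 < μ - e₀`, `μ + e₀ < 0` and every pair potential
`v_{σσ'} : ℤ² → ℝ` with `Σ_x (1 + |x|²)|v_{σσ'}(x)| < ∞`,
`LatticeModelHyp (ε + 4) (μ + 4) e₀ (fun θ e ↦ bandFermiRadius (μ + e) θ) v` — dispersion hypotheses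
(2.8a)–(2.8c) by `klfs_bgm2003_dispersionHyp` shifted to BGM's energy origin, periodicity, positivity with
zero set `2πℤ²`, `e₀ < μ + 4`, and the shell = polar annulus mod `2πℤ²`. [folklore] -/
theorem klfs_bgm2003_latticeModelHyp {μ e₀ : ℝ} (he₀ : 0 < e₀) (h₁ : -4 < μ - e₀) (h₂ : μ + e₀ < 0)
    (v : Fin 2 → Fin 2 → Site 2 → ℝ)
    (hv : ∀ σ σ' : Fin 2, Summable fun x : Site 2 => (1 + ∑ i : Fin 2, ((x i : ℝ)) ^ 2) * |v σ σ' x|) :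
    FermiRG.BGM2003.LatticeModelHyp (fun k => sqDispersion k + 4) (μ + 4) e₀
      (fun θ e => bandFermiRadius (μ + e) θ) v where
  dispersion := klfs_bgm2003_dispersionHyp_add_const 4 (klfs_bgm2003_dispersionHyp he₀ h₁ h₂)
  periodic m k := by rw [klfs_sqDispersion_add_int_mul]
  nonneg := klfs_sqDispersion_add_four_nonneg
  eq_zero_iff := klfs_sqDispersion_add_four_eq_zero_iff
  e₀_lt := by linarith
  shell_eq k hk := by
    have hk' : |sqDispersion k - μ| ≤ e₀ := by
      rw [show sqDispersion k - μ = sqDispersion k + 4 - (μ + 4) by ring]; exact hk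
    exact klfs_shell_eq_levelPoint h₁ h₂ k hk'
  potential_summable := hv

/-- **Finitely supported potentials** (e.g. the on-site Hubbard repulsion, or any finite-range `v`) have a
summable second moment, so the Hubbard band with any such `v` is in the class. [folklore] -/
theorem klfs_bgm2003_latticeModelHyp_of_finite {μ e₀ : ℝ} (he₀ : 0 < e₀) (h₁ : -4 < μ - e₀) (h₂ : μ + e₀ < 0)
    (v : Fin 2 → Fin 2 → Site 2 → ℝ) (hv : ∀ σ σ' : Fin 2, (Function.support (v σ σ')).Finite) :
    FermiRG.BGM2003.LatticeModelHyp (fun k => sqDispersion k + 4) (μ + 4) e₀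
      (fun θ e => bandFermiRadius (μ + e) θ) v := by
  refine klfs_bgm2003_latticeModelHyp he₀ h₁ h₂ v fun σ σ' => ?_
  refine summable_of_hasFiniteSupport ((hv σ σ').subset fun x hx => ?_)
  rw [Function.mem_support] at hx ⊢
  intro h0
  apply hx
  rw [h0, abs_zero, mul_zero]

/-- **On the certified window** `μ ∈ [-0.4267, -0.1798]` (image of `δ ∈ [0.10, 0.20]`), shell width
`e₀ = 0.08`, any finitely supported pair potential. [folklore] -/
theorem klfs_window_bgm2003_latticeModelHyp {μ : ℝ} (hμ : μ ∈ Icc (-0.4267 : ℝ) (-0.1798))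
    (v : Fin 2 → Fin 2 → Site 2 → ℝ) (hv : ∀ σ σ' : Fin 2, (Function.support (v σ σ')).Finite) :
    FermiRG.BGM2003.LatticeModelHyp (fun k => sqDispersion k + 4) (μ + 4) 0.08
      (fun θ e => bandFermiRadius (μ + e) θ) v :=
  klfs_bgm2003_latticeModelHyp_of_finite (by norm_num) (by linarith [hμ.1]) (by linarith [hμ.2]) v hv

/-- **On the analysis window** `μ ∈ [-1, -0.15]` of K1/K3, shell width `e₀ = 0.07`, any finitely supported
pair potential. [folklore] -/
theorem klfs_analysisWindow_bgm2003_latticeModelHyp {μ : ℝ} (hμ : μ ∈ Icc (-1 : ℝ) (-0.15))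
    (v : Fin 2 → Fin 2 → Site 2 → ℝ) (hv : ∀ σ σ' : Fin 2, (Function.support (v σ σ')).Finite) :
    FermiRG.BGM2003.LatticeModelHyp (fun k => sqDispersion k + 4) (μ + 4) 0.07
      (fun θ e => bandFermiRadius (μ + e) θ) v :=
  klfs_bgm2003_latticeModelHyp_of_finite (by norm_num) (by linarith [hμ.1]) (by linarith [hμ.2]) v hv

/-! ### §5 Conditional corollary: the typed Theorem 1.1 binds to the Hubbard carrier -/

/-- **BGM 2003 Theorem 1.1 (lattice, as typed) applied to the Hubbard band** — CONDITIONAL on the named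
fact `FermiRG.BGM2003.theorem11_lattice` (Benfatto–Giuliani–Mastropietro, Ann. Henri Poincaré 4 (2003)
137, Thm 1.1 (2.11); unproved in the tree): for `0 < e₀`, `-4 < μ - e₀`, `μ + e₀ < 0` and any pair
potential with summable second moment, the typed conclusion (existence of `λ₀, c₀, c, C` and a
`2πℤ²`-periodic continuous counterterm `ν̂ = O(λ)` such that for `|λ| ≤ λ₀`, `c₀|λ| log β ≤ 1` the
infinite-volume two-point function of the model with dispersion `ε + 4` at chemical potential `μ + 4`
exists and is `ĝ(1 + λŜ₁)`, `|Ŝ₁| ≤ c`) holds verbatim. Nothing about K1/K3 is asserted; the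
identification of `schwingerL` with the tree's Hubbard objects is not part of this statement. [folklore] -/
theorem klfs_bgm2003_theorem11_hubbard (hT : FermiRG.BGM2003.theorem11_lattice)
    {μ e₀ : ℝ} (he₀ : 0 < e₀) (h₁ : -4 < μ - e₀) (h₂ : μ + e₀ < 0)
    (v : Fin 2 → Fin 2 → Site 2 → ℝ)
    (hv : ∀ σ σ' : Fin 2, Summable fun x : Site 2 => (1 + ∑ i : Fin 2, ((x i : ℝ)) ^ 2) * |v σ σ' x|) :
    ∃ (lam₀ c₀ c C : ℝ) (ν : (Fin 2 → ℝ) → ℝ → ℝ → ℝ), 0 < lam₀ ∧ 0 < c₀ ∧ 0 < c ∧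
      (∀ β : ℝ, Continuous fun q : (Fin 2 → ℝ) × ℝ => ν q.1 q.2 β) ∧
      (∀ (k : Fin 2 → ℝ) (lam β : ℝ), |lam| ≤ lam₀ → 0 < β → |ν k lam β| ≤ C * |lam|) ∧
      (∀ (m : Fin 2 → ℤ) (k : Fin 2 → ℝ) (lam β : ℝ),
        ν (k + fun i => 2 * π * (m i : ℝ)) lam β = ν k lam β) ∧
      ∀ (lam β : ℝ), |lam| ≤ lam₀ → 0 < β → c₀ * |lam| * Real.log β ≤ 1 → ∀ σ : Fin 2,
        ∃ S : ℝ → Site 2 → ℂ,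
          (∀ x₀ ∈ Set.Ico 0 β, ∀ x : Site 2,
            Tendsto (fun L : ℕ => FermiRG.BGM2003.schwingerL (fun k => sqDispersion k + 4) (μ + 4)
              (fun k => ν k lam β) lam v β L σ x₀ x 0 0) atTop (𝓝 (S x₀ x))) ∧
          (∀ x₀ ∈ Set.Ico 0 β, Summable fun x : Site 2 => ‖S x₀ x‖) ∧
          (∀ (k₀ : ℝ) (k : Fin 2 → ℝ), IntervalIntegrable (fun x₀ : ℝ => ∑' x : Site 2,
              Complex.exp (Complex.I * (((k₀ * x₀ + ∑ i : Fin 2, k i * (x i : ℝ) : ℝ)) : ℂ)) * S x₀ x)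
            volume 0 β) ∧
          ∃ S₁ : ℝ → (Fin 2 → ℝ) → ℂ, (∀ (k₀ : ℝ) (k : Fin 2 → ℝ), ‖S₁ k₀ k‖ ≤ c) ∧
            ∀ (m : ℤ) (k : Fin 2 → ℝ),
              FermiRG.BGM2003.fourierTwoPoint β S (FermiRG.BGM2003.matsubara β m) k =
                FermiRG.BGM2003.freePropagator (fun k => sqDispersion k + 4) (μ + 4)
                  (FermiRG.BGM2003.matsubara β m) k * (1 + lam * S₁ (FermiRG.BGM2003.matsubara β m) k) :=
  hT _ _ _ _ _ (klfs_bgm2003_latticeModelHyp he₀ h₁ h₂ v hv)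

end Summit.HubbardSuperconductivity.HubbardSuperconductivity.Theorems

end
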